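import Summits.AtomisticToContinuum.Crystallization.Theorems.FreeSplittingCertificatesRadiusLadderCompactness
import Literature.MathematicalPhysics.StatisticalMechanics.TwoScaleShellSums

/-!
# Free splitting certificates — hard-core removal on the radius ladder, I: the thinned rule
(route `FreeSplittingCertificates`, crux r2 `FiniteRangeSplitting`, stmt-AtomisticToContinuum-12559; crux r5
stmt-AtomisticToContinuum-12562)

VALUE = a structural theorem about the crux (with part II it removes the quantifier `∀ δ > 0` of crux r2 down to
ONE hard core `δ₀ = 2/5`) — NOT summit progress.

**The step** (`arungAt_hardCore_step`, `rungAt_hardCore_step`): for `0 < s ≤ η ≤ 8/9`, `R ≥ 0` and the load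
condition `(250/6)(9/8)³ s⁻³ ≤ V_LJ(η)/2`, a (`ε`-)rung at hard core `η` and radius `R` gives a (`ε`-)rung at hard
core `s` and radius `R + η`.

**Mechanism (the thinned rule).** Given a rule `Φ` feasible at hard core `η` and radius `R`, the rule
`thinRule η R Φ` read at radius `R + η` decides each bond `i → j` from the pattern alone: call a pattern point
CROWDED if another pattern point lies within `< η` of it. If the origin (site `i`) is crowded, the bond gets
weight `1/2` (if `x_j − x_i` is crowded too) or `1` (if not); if the origin is uncrowded and `x_j − x_i` is
crowded, weight `0`; if both are uncrowded, the weight is `Φ` evaluated on the THINNED pattern (the uncrowded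
pattern points within `R` of an endpoint). Complementarity survives because crowdedness is translation
invariant (`isRule_thinRule`). Feasibility on `s`-separated configurations: an uncrowded site sees exactly the
site energy of `Φ` at radius `R` on the sub-configuration of uncrowded sites, which is `η`-separated
(`siteE_thinRule_of_unc`); a crowded site has a partner at distance `< η` whose half bond pays `≥ V_LJ(η)/2`,
while its total attraction is `≤ (250/6)(9/8)³ s⁻³` (two-scale shell sum `sum_inv_pow_six_le_two_scale`, every
attractive partner being at distance `≥ 8/9` since `(8/9)⁶ < 1/2`), so its weighted site energy is `≥ 0 ≥ e_∞`
under the load condition (`siteE_thinRule_of_crowded`). Part II (`…RadiusLadderHardCoreLadder`) iterates the step.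
-/

noncomputable section

open scoped BigOperators Classical
open Literature.MathematicalPhysics.StatisticalMechanics

namespace Summit.AtomisticToContinuum.Crystallization.Theorems.StrictSplittingRuleBirth

/-- Euclidean `3`-space. -/
local notation "E3" => EuclideanSpace ℝ (Fin 3)

/-! ## §1  Crowded pattern points and the thinned rule -/

/-- `u` is `η`-CROWDED in the pattern `T`: another point of `T` lies within `< η` of it. [folklore] -/
def CrowdedIn (η : ℝ) (T : Finset E3) (u : E3) : Prop := ∃ w ∈ T, w ≠ u ∧ dist w u < η

/-- The thinned pattern of the bond `0 → v`: the uncrowded points of `T` within `R` of an endpoint. [folklore] -/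
def thinPat (η R : ℝ) (v : E3) (T : Finset E3) : Finset E3 :=
  T.filter fun u => ¬ CrowdedIn η T u ∧ (‖u‖ ≤ R ∨ dist u v ≤ R)

/-- **The thinned rule** `thinRule η R Φ` (see the module docstring). [folklore] -/
def thinRule (η R : ℝ) (Φ : E3 → Finset E3 → ℝ) : E3 → Finset E3 → ℝ := fun v T =>
  if CrowdedIn η T 0 then (if CrowdedIn η T v then 1 / 2 else 1)
  else if CrowdedIn η T v then 0 else Φ v (thinPat η R v T)

/-- Crowdedness is translation invariant. -/
theorem crowdedIn_image_sub (η : ℝ) (T : Finset E3) (v u : E3) :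
    CrowdedIn η (T.image fun w => w - v) (u - v) ↔ CrowdedIn η T u := by
  unfold CrowdedIn
  constructor
  · rintro ⟨w, hw, hne, hd⟩
    obtain ⟨w', hw', rfl⟩ := Finset.mem_image.1 hw
    refine ⟨w', hw', fun h => hne (by rw [h]), ?_⟩
    rwa [dist_sub_right] at hd
  · rintro ⟨w', hw', hne, hd⟩
    refine ⟨w' - v, Finset.mem_image_of_mem _ hw', fun h => hne (sub_left_injective h), ?_⟩
    rwa [dist_sub_right]

/-- The recentred pattern is crowded at the new origin iff the old pattern is crowded at `v`. -/
theorem crowdedIn_image_sub_zero (η : ℝ) (T : Finset E3) (v : E3) :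
    CrowdedIn η (T.image fun w => w - v) 0 ↔ CrowdedIn η T v := by
  simpa using crowdedIn_image_sub η T v v

/-- The recentred pattern is crowded at `-v` iff the old pattern is crowded at the origin. -/
theorem crowdedIn_image_sub_neg (η : ℝ) (T : Finset E3) (v : E3) :
    CrowdedIn η (T.image fun w => w - v) (-v) ↔ CrowdedIn η T 0 := by
  simpa using crowdedIn_image_sub η T v 0

/-- The thinned pattern commutes with recentring. -/
theorem thinPat_image_sub (η R : ℝ) (v : E3) (T : Finset E3) :
    thinPat η R (-v) (T.image fun w => w - v) = (thinPat η R v T).image fun w => w - v := by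
  unfold thinPat
  rw [Finset.filter_image]
  congr 1
  refine Finset.filter_congr fun w _ => ?_
  rw [crowdedIn_image_sub, dist_eq_norm, dist_eq_norm, sub_neg_eq_add, sub_add_cancel, or_comm]

/-- **The thinned rule is a rule** (box and complementarity). -/
theorem isRule_thinRule {η R : ℝ} {Φ : E3 → Finset E3 → ℝ} (hΦ : IsRule Φ) : IsRule (thinRule η R Φ) := by
  refine ⟨fun v T => ?_, fun v T hv => ?_⟩
  · unfold thinRule
    split_ifs
    · norm_num
    · norm_num
    · norm_num
    · exact hΦ.1 _ _
  · have h0 := crowdedIn_image_sub_zero η T v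
    have hn := crowdedIn_image_sub_neg η T v
    by_cases hc0 : CrowdedIn η T 0 <;> by_cases hcv : CrowdedIn η T v
    · simp only [thinRule, if_pos hc0, if_pos hcv, if_pos (h0.2 hcv), if_pos (hn.2 hc0)]; norm_num
    · simp only [thinRule, if_pos hc0, if_neg hcv, if_neg (mt h0.1 hcv), if_pos (hn.2 hc0)]; norm_num
    · simp only [thinRule, if_neg hc0, if_pos hcv, if_pos (h0.2 hcv), if_neg (mt hn.1 hc0)]; norm_num
    · simp only [thinRule, if_neg hc0, if_neg hcv, if_neg (mt h0.1 hcv), if_neg (mt hn.1 hc0)]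
      rw [thinPat_image_sub]
      exact hΦ.2 v _ hv

/-! ## §2  Realised patterns: crowded pattern points are crowded sites -/

/-- Site `l` is `η`-UNCROWDED in the configuration `x`: every other site is at distance `≥ η`. [folklore] -/
def Unc (η : ℝ) {N : ℕ} (x : Fin N → E3) (l : Fin N) : Prop := ∀ m : Fin N, m ≠ l → η ≤ dist (x m) (x l)

/-- In the realised pattern of the bond `i → j` read at radius `R + η`, a pattern point `x_l − x_i` with `x_l`
within `R` of an endpoint is crowded iff the site `l` is crowded. -/
theorem crowdedIn_bondPattern_iff {η R : ℝ} {N : ℕ} {x : Fin N → E3} (hx : Function.Injective x)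
    {i j l : Fin N} (hl : dist (x l) (x i) ≤ R ∨ dist (x l) (x j) ≤ R) :
    CrowdedIn η (bondPattern (R + η) x i j) (x l - x i) ↔ ¬ Unc η x l := by
  unfold CrowdedIn Unc bondPattern
  constructor
  · rintro ⟨w, hw, hne, hd⟩ hU
    simp only [Finset.mem_image, Finset.mem_filter, Finset.mem_univ, true_and] at hw
    obtain ⟨m, -, rfl⟩ := hw
    have hml : m ≠ l := fun h => hne (by rw [h])
    rw [dist_sub_right] at hd
    exact (not_lt.2 (hU m hml)) hd
  · intro h
    push Not at h
    obtain ⟨m, hml, hd⟩ := h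
    refine ⟨x m - x i, ?_, fun heq => hml (hx (sub_left_injective heq)), by rwa [dist_sub_right]⟩
    simp only [Finset.mem_image, Finset.mem_filter, Finset.mem_univ, true_and]
    refine ⟨m, ?_, rfl⟩
    rcases hl with h1 | h2
    · left
      linarith [dist_triangle (x m) (x l) (x i)]
    · right
      linarith [dist_triangle (x m) (x l) (x j)]

/-- The origin of the realised pattern of `i → j` (radius `R + η`, `R ≥ 0`) is crowded iff site `i` is. -/
theorem crowdedIn_bondPattern_zero_iff {η R : ℝ} (hR : 0 ≤ R) {N : ℕ} {x : Fin N → E3}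
    (hx : Function.Injective x) (i j : Fin N) :
    CrowdedIn η (bondPattern (R + η) x i j) 0 ↔ ¬ Unc η x i := by
  have h := crowdedIn_bondPattern_iff (η := η) (R := R) hx (i := i) (j := j) (l := i)
    (Or.inl (by rw [dist_self]; exact hR))
  rwa [sub_self] at h

/-- The far endpoint of the realised pattern of `i → j` (radius `R + η`, `R ≥ 0`) is crowded iff site `j` is. -/
theorem crowdedIn_bondPattern_end_iff {η R : ℝ} (hR : 0 ≤ R) {N : ℕ} {x : Fin N → E3}
    (hx : Function.Injective x) (i j : Fin N) :
    CrowdedIn η (bondPattern (R + η) x i j) (x j - x i) ↔ ¬ Unc η x j :=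
  crowdedIn_bondPattern_iff hx (Or.inr (by rw [dist_self]; exact hR))

/-- The thinned realised pattern of `i → j` is the pattern of the uncrowded sites within `R` of an endpoint. -/
theorem thinPat_bondPattern {η R : ℝ} (hη : 0 ≤ η) {N : ℕ} {x : Fin N → E3} (hx : Function.Injective x)
    (i j : Fin N) :
    thinPat η R (x j - x i) (bondPattern (R + η) x i j) =
      (Finset.univ.filter fun l => Unc η x l ∧ (dist (x l) (x i) ≤ R ∨ dist (x l) (x j) ≤ R)).image
        fun l => x l - x i := by
  ext u
  simp only [thinPat, Finset.mem_filter, Finset.mem_image, Finset.mem_univ, true_and]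
  constructor
  · rintro ⟨hu, hnc, hR⟩
    obtain ⟨l, -, rfl⟩ : ∃ l, (dist (x l) (x i) ≤ R + η ∨ dist (x l) (x j) ≤ R + η) ∧ x l - x i = u := by
      simpa [bondPattern] using hu
    rw [← dist_eq_norm, dist_sub_right] at hR
    exact ⟨l, ⟨not_not.1 ((crowdedIn_bondPattern_iff hx hR).not.1 hnc), hR⟩, rfl⟩
  · rintro ⟨l, ⟨hU, hlR⟩, rfl⟩
    refine ⟨?_, fun hc => ((crowdedIn_bondPattern_iff hx hlR).1 hc) hU, by rwa [← dist_eq_norm, dist_sub_right]⟩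
    simp only [bondPattern, Finset.mem_image, Finset.mem_filter, Finset.mem_univ, true_and]
    exact ⟨l, hlR.imp (fun h => h.trans (le_add_of_nonneg_right hη))
      (fun h => h.trans (le_add_of_nonneg_right hη)), rfl⟩

/-! ## §3  The sub-configuration of uncrowded sites -/

/-- The uncrowded sites. -/
def uncSet (η : ℝ) {N : ℕ} (x : Fin N → E3) : Finset (Fin N) := Finset.univ.filter fun l => Unc η x l

/-- Membership in `uncSet`. -/
theorem mem_uncSet {η : ℝ} {N : ℕ} {x : Fin N → E3} {l : Fin N} : l ∈ uncSet η x ↔ Unc η x l := by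
  simp [uncSet]

/-- The sub-configuration of uncrowded sites, reindexed by `Fin`. -/
def subConf (η : ℝ) {N : ℕ} (x : Fin N → E3) : Fin (uncSet η x).card → E3 :=
  fun m => x ((uncSet η x).equivFin.symm m).1

/-- The sub-configuration at the new index of an uncrowded site is that site. -/
theorem subConf_apply (η : ℝ) {N : ℕ} (x : Fin N → E3) {l : Fin N} (hl : l ∈ uncSet η x) :
    subConf η x ((uncSet η x).equivFin ⟨l, hl⟩) = x l := by
  simp [subConf]

/-- The sub-configuration of `η`-uncrowded sites is `η`-separated. -/
theorem sep_subConf (η : ℝ) {N : ℕ} (x : Fin N → E3) : Sep η (subConf η x) := by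
  intro m m' hne
  have hne' : ((uncSet η x).equivFin.symm m).1 ≠ ((uncSet η x).equivFin.symm m').1 := fun h =>
    hne ((uncSet η x).equivFin.symm.injective (Subtype.ext h))
  have hU : Unc η x ((uncSet η x).equivFin.symm m').1 := mem_uncSet.1 ((uncSet η x).equivFin.symm m').2
  exact hU _ hne'

/-- Bond patterns of the sub-configuration are the uncrowded parts of the bond patterns. -/
theorem bondPattern_subConf {η : ℝ} (R : ℝ) {N : ℕ} (x : Fin N → E3) {i j : Fin N} (hi : i ∈ uncSet η x)
    (hj : j ∈ uncSet η x) :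
    bondPattern R (subConf η x) ((uncSet η x).equivFin ⟨i, hi⟩) ((uncSet η x).equivFin ⟨j, hj⟩) =
      (Finset.univ.filter fun l => Unc η x l ∧ (dist (x l) (x i) ≤ R ∨ dist (x l) (x j) ≤ R)).image
        fun l => x l - x i := by
  ext u
  simp only [bondPattern, Finset.mem_image, Finset.mem_filter, Finset.mem_univ, true_and, subConf_apply]
  constructor
  · rintro ⟨m, hm, rfl⟩
    refine ⟨((uncSet η x).equivFin.symm m).1, ⟨mem_uncSet.1 ((uncSet η x).equivFin.symm m).2, ?_⟩, ?_⟩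
    · simpa [subConf] using hm
    · simp [subConf]
  · rintro ⟨l, ⟨hU, hl⟩, rfl⟩
    refine ⟨(uncSet η x).equivFin ⟨l, mem_uncSet.2 hU⟩, ?_, ?_⟩
    · simpa [subConf_apply] using hl
    · simp [subConf_apply]

/-- **An uncrowded site sees, under the thinned rule at radius `R + η`, exactly the site energy of `Φ` at radius
`R` on the sub-configuration of uncrowded sites.** -/
theorem siteE_thinRule_of_unc {η R : ℝ} (hη : 0 ≤ η) (hR : 0 ≤ R) (Φ : E3 → Finset E3 → ℝ) {N : ℕ}
    {x : Fin N → E3} (hx : Function.Injective x) {i : Fin N} (hi : i ∈ uncSet η x) :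
    siteE (R + η) (thinRule η R Φ) x i = siteE R Φ (subConf η x) ((uncSet η x).equivFin ⟨i, hi⟩) := by
  set U := uncSet η x with hU_def
  set e := U.equivFin with he_def
  have hiU : Unc η x i := mem_uncSet.1 hi
  rw [perturbative_siteE_eq, perturbative_siteE_eq]
  -- the summand at a crowded `j` vanishes, at an uncrowded `j` it is `Φ` on the thinned pattern
  have hsum : ∀ j ∈ Finset.univ.erase i,
      thinRule η R Φ (x j - x i) (bondPattern (R + η) x i j) * lennardJones (dist (x i) (x j)) =
        if Unc η x j then Φ (x j - x i) ((Finset.univ.filter fun l => Unc η x l ∧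
          (dist (x l) (x i) ≤ R ∨ dist (x l) (x j) ≤ R)).image fun l => x l - x i) *
            lennardJones (dist (x i) (x j)) else 0 := by
    intro j _
    have h0 : ¬ CrowdedIn η (bondPattern (R + η) x i j) 0 :=
      fun h => ((crowdedIn_bondPattern_zero_iff hR hx i j).1 h) hiU
    by_cases hj : Unc η x j
    · have h1 : ¬ CrowdedIn η (bondPattern (R + η) x i j) (x j - x i) :=
        fun h => ((crowdedIn_bondPattern_end_iff hR hx i j).1 h) hj
      simp only [thinRule, if_neg h0, if_neg h1, if_pos hj, thinPat_bondPattern hη hx]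
    · have h1 : CrowdedIn η (bondPattern (R + η) x i j) (x j - x i) :=
        (crowdedIn_bondPattern_end_iff hR hx i j).2 hj
      simp only [thinRule, if_neg h0, if_pos h1, if_neg hj, zero_mul]
  rw [Finset.sum_congr rfl hsum, ← Finset.sum_filter]
  -- reindex the uncrowded `j ≠ i` by `Fin U.card`
  refine Finset.sum_bij' (fun j hj => e ⟨j, (Finset.mem_filter.1 hj).2 |> mem_uncSet.2⟩)
    (fun m _ => (e.symm m).1) ?_ ?_ ?_ ?_ ?_
  · intro j hj
    have hji : j ≠ i := Finset.ne_of_mem_erase (Finset.mem_filter.1 hj).1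
    refine Finset.mem_erase.2 ⟨fun h => hji ?_, Finset.mem_univ _⟩
    have := congrArg Subtype.val (e.injective h)
    simpa using this
  · intro m hm
    have hmi : m ≠ e ⟨i, hi⟩ := Finset.ne_of_mem_erase hm
    refine Finset.mem_filter.2 ⟨Finset.mem_erase.2 ⟨fun h => hmi ?_, Finset.mem_univ _⟩,
      mem_uncSet.1 (e.symm m).2⟩
    rw [← e.apply_symm_apply m]
    congr 1
    exact Subtype.ext h
  · intro j hj
    simp
  · intro m hm
    simp
  · intro j hj
    have hjU : j ∈ U := mem_uncSet.2 (Finset.mem_filter.1 hj).2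
    rw [bondPattern_subConf R x hi hjU, subConf_apply, subConf_apply]

/-! ## §4  A crowded site pays for itself -/

/-- A bond carrying a weight `c ∈ [0, 1]` contributes at least minus its attractive part, and an attractive
bond has length `≥ 8/9` (`(8/9)⁶ < 1/2`). -/
theorem weight_mul_lennardJones_ge {c d : ℝ} (hc0 : 0 ≤ c) (hc1 : c ≤ 1) (hd : 0 < d) :
    -(if (8 : ℝ) / 9 ≤ d then 1 / 6 * d⁻¹ ^ 6 else 0) ≤ c * lennardJones d := by
  split_ifs with h89
  · have h12 : 0 ≤ d⁻¹ ^ 12 := by positivity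
    have hV : -(1 / 6 * d⁻¹ ^ 6) ≤ lennardJones d := by unfold lennardJones; linarith
    by_cases hs : 0 ≤ lennardJones d
    · have h6 : 0 ≤ 1 / 6 * d⁻¹ ^ 6 := by positivity
      nlinarith [mul_nonneg hc0 hs]
    · push Not at hs
      nlinarith [mul_le_mul_of_nonpos_right hc1 hs.le]
  · push Not at h89
    have h6 : d ^ 6 ≤ 1 / 2 := (pow_le_pow_left₀ hd.le h89.le 6).trans (by norm_num)
    have hV : 0 ≤ lennardJones d := by
      by_contra hneg
      push Not at hneg
      exact (not_lt.2 h6) ((perturbative_lennardJones_neg_iff hd).1 hneg)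
    simpa using mul_nonneg hc0 hV

/-- **A crowded site pays for itself.** On an `s`-separated configuration (`0 < s ≤ η ≤ 8/9`), a site with a
partner at distance `< η` has, under the thinned rule at radius `R + η`, weighted site energy
`≥ V_LJ(η)/2 − (250/6)(9/8)³ s⁻³`: the half bond to the partner pays `≥ V_LJ(η)/2`, every other bond costs at
most its attractive part, and the attractive partners (all at distance `≥ 8/9`) have `∑ d⁻⁶ ≤ 250 s⁻³ (8/9)⁻³`
(`sum_inv_pow_six_le_two_scale`). -/
theorem siteE_thinRule_of_crowded {s η R : ℝ} (hs : 0 < s) (hsη : s ≤ η) (hη89 : η ≤ 8 / 9) (hR : 0 ≤ R)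
    {Φ : E3 → Finset E3 → ℝ} (hΦ : IsRule Φ) {N : ℕ} {x : Fin N → E3} (hx : Sep s x) {i : Fin N}
    (hi : ¬ Unc η x i) :
    lennardJones η / 2 - 1 / 6 * (250 * s⁻¹ ^ 3 * (8 / 9 : ℝ)⁻¹ ^ 3) ≤
      siteE (R + η) (thinRule η R Φ) x i := by
  have hxinj := perturbative_injective_of_sep hs hx
  have hrule := isRule_thinRule (η := η) (R := R) hΦ
  obtain ⟨p, hpi, hdp⟩ : ∃ p, p ≠ i ∧ dist (x p) (x i) < η := by
    unfold Unc at hi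
    push Not at hi
    exact hi
  have hpU : ¬ Unc η x p := by
    intro hU
    have h := hU i hpi.symm
    rw [dist_comm] at h
    exact (not_lt.2 h) hdp
  have h0 : ∀ j, CrowdedIn η (bondPattern (R + η) x i j) 0 := fun j =>
    (crowdedIn_bondPattern_zero_iff hR hxinj i j).2 hi
  rw [perturbative_siteE_eq]
  have hterm : ∀ j ∈ Finset.univ.erase i,
      (if j = p then lennardJones η / 2 else 0) -
          (if (8 : ℝ) / 9 ≤ dist (x i) (x j) then 1 / 6 * (dist (x i) (x j))⁻¹ ^ 6 else 0) ≤
        thinRule η R Φ (x j - x i) (bondPattern (R + η) x i j) * lennardJones (dist (x i) (x j)) := by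
    intro j hj
    have hji : j ≠ i := Finset.ne_of_mem_erase hj
    have hd0 : 0 < dist (x i) (x j) := hs.trans_le (hx i j hji.symm)
    by_cases hjp : j = p
    · subst hjp
      have hw : thinRule η R Φ (x j - x i) (bondPattern (R + η) x i j) = 1 / 2 := by
        simp only [thinRule, if_pos (h0 j), if_pos ((crowdedIn_bondPattern_end_iff hR hxinj i j).2 hpU)]
      have hdη : dist (x i) (x j) ≤ η := by rw [dist_comm]; exact hdp.le
      have h89 : ¬ (8 : ℝ) / 9 ≤ dist (x i) (x j) := not_le.2 (by rw [dist_comm]; linarith)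
      rw [hw, if_pos rfl, if_neg h89, sub_zero]
      -- `V_LJ` is antitone on `(0, 1]` (cf. `PhononSlackCertificatesNearFarGlueR.lennardJones_le_of_le_one`)
      have h : lennardJones η ≤ lennardJones (dist (x i) (x j)) := by
        have ht0 : 0 < η := hd0.trans_le hdη
        have hti : 1 ≤ η⁻¹ := by rw [inv_eq_one_div, le_div_iff₀ ht0]; linarith
        have hw1 : 1 ≤ η⁻¹ ^ 6 := one_le_pow₀ hti
        have huw : η⁻¹ ^ 6 ≤ (dist (x i) (x j))⁻¹ ^ 6 :=
          pow_le_pow_left₀ (inv_nonneg.2 ht0.le) (inv_anti₀ hd0 hdη) 6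
        have h12r : (dist (x i) (x j))⁻¹ ^ 12 = (dist (x i) (x j))⁻¹ ^ 6 * (dist (x i) (x j))⁻¹ ^ 6 := by ring
        have h12t : η⁻¹ ^ 12 = η⁻¹ ^ 6 * η⁻¹ ^ 6 := by ring
        unfold lennardJones
        rw [h12r, h12t]
        nlinarith [mul_nonneg (sub_nonneg.2 huw)
          (by linarith : (0 : ℝ) ≤ (dist (x i) (x j))⁻¹ ^ 6 + η⁻¹ ^ 6 - 2)]
      linarith
    · rw [if_neg hjp, zero_sub]
      have hb := hrule.1 (x j - x i) (bondPattern (R + η) x i j)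
      exact weight_mul_lennardJones_ge hb.1 hb.2 hd0
  refine le_trans ?_ (Finset.sum_le_sum hterm)
  rw [Finset.sum_sub_distrib, Finset.sum_ite_eq' (Finset.univ.erase i) p,
    if_pos (Finset.mem_erase.2 ⟨hpi, Finset.mem_univ p⟩), ← Finset.sum_filter]
  have hload : ∑ j ∈ (Finset.univ.erase i).filter (fun j => (8 : ℝ) / 9 ≤ dist (x i) (x j)),
      1 / 6 * (dist (x i) (x j))⁻¹ ^ 6 ≤ 1 / 6 * (250 * s⁻¹ ^ 3 * (8 / 9 : ℝ)⁻¹ ^ 3) := by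
    rw [← Finset.mul_sum]
    refine mul_le_mul_of_nonneg_left ?_ (by norm_num)
    set F := (Finset.univ.erase i).filter (fun j => (8 : ℝ) / 9 ≤ dist (x i) (x j)) with hF
    have key := sum_inv_pow_six_le_two_scale (F.image x) (x i) hs (hsη.trans hη89) ?_ ?_
    · rwa [Finset.sum_image (hxinj.injOn)] at key
    · intro z hz w hw hzw
      obtain ⟨a, -, rfl⟩ := Finset.mem_image.1 hz
      obtain ⟨b, -, rfl⟩ := Finset.mem_image.1 hw
      exact hx a b fun h => hzw (by rw [h])
    · intro z hz
      obtain ⟨a, ha, rfl⟩ := Finset.mem_image.1 hz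
      exact (Finset.mem_filter.1 ha).2
  linarith

/-! ## §5  The hard-core removal step -/

/-- **Hard-core removal, one step (`ε`-rungs).** If `0 < s ≤ η ≤ 8/9`, `R ≥ 0`, `ε ≥ 0` and the load condition
`(250/6)(9/8)³ s⁻³ ≤ V_LJ(η)/2` holds, then an `ε`-feasible rule at `(η, R)` yields the `ε`-feasible thinned
rule at `(s, R + η)`. -/
theorem afeasible_thinRule {s η ε R : ℝ} (hs : 0 < s) (hsη : s ≤ η) (hη89 : η ≤ 8 / 9) (hR : 0 ≤ R)
    (hε : 0 ≤ ε) (hload : 1 / 6 * (250 * s⁻¹ ^ 3 * (8 / 9 : ℝ)⁻¹ ^ 3) ≤ lennardJones η / 2)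
    {Φ : E3 → Finset E3 → ℝ} (hΦ : IsRule Φ) (hf : AFeasible η ε R Φ) :
    AFeasible s ε (R + η) (thinRule η R Φ) := by
  intro N x hx i
  by_cases hi : Unc η x i
  · have hiU : i ∈ uncSet η x := mem_uncSet.2 hi
    rw [siteE_thinRule_of_unc (hs.le.trans hsη) hR Φ (perturbative_injective_of_sep hs hx) hiU]
    exact hf _ (subConf η x) (sep_subConf η x) _
  · have h := siteE_thinRule_of_crowded hs hsη hη89 hR hΦ hx hi
    have he : eInf ≤ 0 := eInf_le_ref.trans (by norm_num)
    linarith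

/-- **Hard-core removal, one step**: `ARungAt η ε R → ARungAt s ε (R + η)` under the load condition. -/
theorem arungAt_hardCore_step {s η ε R : ℝ} (hs : 0 < s) (hsη : s ≤ η) (hη89 : η ≤ 8 / 9) (hR : 0 ≤ R)
    (hε : 0 ≤ ε) (hload : 1 / 6 * (250 * s⁻¹ ^ 3 * (8 / 9 : ℝ)⁻¹ ^ 3) ≤ lennardJones η / 2) :
    ARungAt η ε R → ARungAt s ε (R + η) := by
  rintro ⟨Φ, hr, hf⟩
  exact ⟨thinRule η R Φ, isRule_thinRule hr, afeasible_thinRule hs hsη hη89 hR hε hload hr hf⟩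

/-- **Hard-core removal, one step (rungs)**: `RungAt η R → RungAt s (R + η)` under the load condition. -/
theorem rungAt_hardCore_step {s η R : ℝ} (hs : 0 < s) (hsη : s ≤ η) (hη89 : η ≤ 8 / 9) (hR : 0 ≤ R)
    (hload : 1 / 6 * (250 * s⁻¹ ^ 3 * (8 / 9 : ℝ)⁻¹ ^ 3) ≤ lennardJones η / 2) :
    RungAt η R → RungAt s (R + η) := by
  rw [← arungAt_zero_iff, ← arungAt_zero_iff]
  exact arungAt_hardCore_step hs hsη hη89 hR le_rfl hload

end Summit.AtomisticToContinuum.Crystallization.Theorems.StrictSplittingRuleBirth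

end
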